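import Summits.NavierStokesRegularity.NavierStokesRegularity.Theses.TypeILiouville
import Summits.NavierStokesRegularity.NavierStokesRegularity.Theorems.TypeILiouvilleTypeIliouvilleLPersistentMild
import HarnessLib

/-!
# Skeleton for crux `TypeIliouvilleL` — route `TypeILiouville`, item stmt-NavierStokesRegularity-10661
# (line `registered` = BC3 birth skeleton; reshaped by the leads, cycles 1–4)

The crux is the KNSS Liouville conjecture (L), verbatim
`Summit.NavierStokesRegularity.NavierStokesRegularity.Theses.TypeILiouville.TypeIliouvilleL`
(definitionally `Literature.Analysis.FluidPDE.LiouvilleConjectureNS`): every bounded ancient mild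
(duality-form) solution of Navier–Stokes (`ν = 1`) on `ℝ³ × (−∞,0)` with a.e.-strongly measurable
slices is spatially constant on every slice.

## The line: time-regime split + far-past recurrence to constants + backward-`L³` Liouville,
## stated in PRINT's class of mild bounded ancient solutions (cycle 4)

By the landed gauge equivalence `TypeIliouvilleL_iff_oseenMild_liouville` (p166043: the Oseen gauge
theorem of cycles 1–2, pieces A, B, C, DE, p158181 p158868 p160871 p161542 p162550) the crux is
EXACTLY KNSS's (L) for print's class: every field `v` which is continuous and uniformly bounded on
`(−∞,0) × ℝ³`, weakly divergence free on every slice and Oseen-mild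
(`v(t) = e^{(t−s)Δ}v(s) − B¹_s(v,v)(t)` for all `s < t < 0`) is constant. Cycle 4 therefore states
BOTH open halves in that class (no Galilean gauge, no parasitic drift):

* `stub_typeIAncientLiouville_knssGauge` — **L'**, the Type-I regime: VERBATIM the open item
  `Summit.NavierStokesRegularity.NavierStokesRegularity.Theses.SymmetryModuliCount.TypeIAncientLiouville`
  (stmt-NavierStokesRegularity-4050, `Iff.rfl`: `stub_typeIAncientLiouville_knssGauge_iff_typeIAncientLiouville`,
  p172099), worked by the crux chains of routes SymmetryModuliCount / ExtremalTypeIConstant;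
* `stub_persistent_mild_backward_L3_recurrence` — **S3ᵐ**, the persistent regime: a mild bounded
  ancient `v` whose sup norm is NOT `O((−t)^{-1/2})` is `L³`-close (`≤ M`) to constants `b_k` along
  some `τ_k → −∞`. It REPLACES the cycle-1–3 stub S3 (`stub_persistent_backward_L3_decay`, same
  statement over the duality-form class) and is weaker than or equal to it
  (`persistentMild_of_persistentL3`, p172276); it is EQUIVALENT to print's (L) restricted to the
  persistent mild bounded ancient solutions (`persistentMild_iff_oseenMild_liouville_persistent`) and
  the skeleton stays lossless: crux ⟺ L' ∧ S3ᵐ (`TypeIliouvilleL_iff_knssGauge_and_persistentMild`).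

Composition (kernel-checked, landed p172276): Type-I branch — KNSS Prop. 4.1 regularity puts a
continuous Type-I Oseen-mild field in L' 's smooth class (`isTypeIAncientMild_of_continuous_oseenMild`),
so `v ≡ 0`; persistent branch — the constants `b_k` of S3ᵐ agree (`L³` modulo a constant propagates,
p149349), the constant Galilean boost (p149911) is bounded in `L³` along `τ_k`, and Albritton–Barker
2019 Thm 1.2 (`AlbrittonBarker2019_liouville_L3_backward_holds`) kills it: `v ≡ b`
(`oseenMild_const_of_backward_L3_modConst`); the crux follows by the Oseen gauge theorem
(`TypeIliouvilleL_of_knssGauge_of_persistentMild`).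

LOAD-BEARING (cycle 4, p172099): the route `TypeILiouville` consumes (L) only through
`TypeIliouvilleLKillsTypeI`, and the tree PROVES `SymmetryModuliCount.LiouvilleKillsTypeI`; hence
`navierStokesRegularity_of_noTypeII_of_typeIAncientLiouville : TypeIliouvilleNoTypeII → L' →
NavierStokesRegularity` — only stub L' is load-bearing for the summit via this route; S3ᵐ (the half
of (L) open "even in the steady-state case", KNSS 2009 p. 3) is carried, not consumed.

Sorries: exactly the TWO open stubs. No new definitions.
-/

set_option linter.dupNamespace false

namespace Summit.NavierStokesRegularity.NavierStokesRegularity.Cruxes.TypeIliouvilleL.Birth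

open MeasureTheory Filter Set Function Metric
open scoped Topology ENNReal NNReal

/-! ### Open stubs (research-sized; both are named open problems) -/

/-- **Stub L' (Type-I Liouville in the KNSS gauge; OPEN — verbatim the existing item
`Summit.NavierStokesRegularity.NavierStokesRegularity.Theses.SymmetryModuliCount.TypeIAncientLiouville`,
stmt-NavierStokesRegularity-4050).** Every field `u` on `(−∞,0) × ℝ³` which is jointly smooth,
has divergence-free slices, solves the Oseen integral equation
`u(t) = e^{(t−s)Δ}u(s) − B¹_s(u,u)(t)` for all `s < t < 0` (KNSS 2009 §4 (i), written out with the
tree's `oseenKernel`) and obeys the Type-I bound `‖u(t,x)‖ ≤ C/√(−t)` vanishes identically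
(KNSS 2009 §1 (L) restricted to Type-I profiles = "no Type-I blow-up", Albritton–Barker 2019
Thm 1.1; known axisymmetric, Seregin–Šverák 2009). The ONLY stub the route's summit chain consumes
(`navierStokesRegularity_of_noTypeII_of_typeIAncientLiouville`, p172099). -/
theorem stub_typeIAncientLiouville_knssGauge :
    ∀ (C : ℝ) (u : ℝ → EuclideanSpace ℝ (Fin 3) → EuclideanSpace ℝ (Fin 3)),
      ContDiffOn ℝ (⊤ : ℕ∞) (Function.uncurry u) (Set.Iio 0 ×ˢ Set.univ) ∧
      (∀ t < 0, Literature.Analysis.FluidPDE.VectorCalculus.IsDivFree (u t)) ∧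
      (∀ s t : ℝ, s < t → t < 0 → ∀ x,
        u t x = Literature.Analysis.FluidPDE.heatFlow (u s) (t - s) x -
          ∫ τ in Set.Ioo s t, ∫ y,
            Literature.Analysis.FluidPDE.oseenKernel (t - τ) (x - y) (u τ y) (u τ y)) ∧
      Literature.Analysis.FluidPDE.HasTypeITimeDecay C u →
      ∀ t < 0, ∀ x, u t x = 0 := by
  sorry

/-- **Stub S3ᵐ (persistent regime in print's mild class: far-past `L³` recurrence to constants;
OPEN).** Every field `v` which is continuous and uniformly bounded on `(−∞,0) × ℝ³`, weakly
divergence free on every slice, Oseen-mild for all `s < t < 0` (KNSS 2009 §1 p. 3, §4 (i): print's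
mild bounded ancient solutions; automatically smooth), and which is NOT in the Type-I regime (its
sup norm is not `O((−t)^{-1/2})`; since `v` is bounded this is a condition at `t → −∞`: steady,
travelling, time-periodic, slowly decaying ancient flows, …) is `L³`-close to constants `b_k` along
some sequence of times `τ_k → −∞`. Equivalent to print's (L) on the persistent class
(`persistentMild_iff_oseenMild_liouville_persistent`); contains every bounded non-constant steady
mild solution in `ℝ³` as a potential counterexample (KNSS 2009 p. 3: (L) is open "even in the
steady-state case"; partial steady Liouville theorems need integrability / decay / sign / symmetry:
Galdi `L^{9/2}`, Chae 2014, Seregin 2016, Chae–Wolf 2019, Bang–Gui–Wang–Xie 2025). Weaker than or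
equal to the cycle-1–3 duality-class stub S3 (`persistentMild_of_persistentL3`). -/
theorem stub_persistent_mild_backward_L3_recurrence :
    ∀ v : ℝ → EuclideanSpace ℝ (Fin 3) → EuclideanSpace ℝ (Fin 3),
      ContinuousOn (uncurry v) (Iio 0 ×ˢ univ) →
      (∃ K : ℝ, ∀ t < 0, ∀ x, ‖v t x‖ ≤ K) →
      (∀ t < 0, Literature.Analysis.FluidPDE.IsWeaklyDivFree (v t)) →
      (∀ s t : ℝ, s < t → t < 0 → ∀ x,
        v t x = Literature.Analysis.UnboundedOperators.heatExtension (v s) (t - s) x -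
          Literature.Analysis.FluidPDE.oseenDuhamel 1 s v v t x) →
      (¬ ∃ C : ℝ, ∀ t < 0, ∀ x, ‖v t x‖ ≤ C / Real.sqrt (-t)) →
      ∃ (b : ℕ → EuclideanSpace ℝ (Fin 3)) (τ : ℕ → ℝ) (M : NNReal),
        (∀ k, τ k < 0) ∧ Tendsto τ atTop atBot ∧
        ∀ k, eLpNorm (fun x => v (τ k) x - b k) 3
          (volume : Measure (EuclideanSpace ℝ (Fin 3))) ≤ (M : ENNReal) := by
  sorry

/-! ### Composition (kernel-checked, no sorry below this line) -/

/-- **(L) for print's mild class from the two stubs** (landed composition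
`oseenMild_liouville_of_knssGauge_of_persistentMild`, p172276): every continuous, uniformly bounded,
weakly divergence-free, Oseen-mild ancient field on `(−∞,0) × ℝ³` is constant in space and time. -/
theorem oseenMild_liouville_of_stubs :
    ∀ v : ℝ → EuclideanSpace ℝ (Fin 3) → EuclideanSpace ℝ (Fin 3),
      ContinuousOn (uncurry v) (Iio 0 ×ˢ univ) →
      (∃ K : ℝ, ∀ t < 0, ∀ x, ‖v t x‖ ≤ K) →
      (∀ t < 0, Literature.Analysis.FluidPDE.IsWeaklyDivFree (v t)) →
      (∀ s t : ℝ, s < t → t < 0 → ∀ x,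
        v t x = Literature.Analysis.UnboundedOperators.heatExtension (v s) (t - s) x -
          Literature.Analysis.FluidPDE.oseenDuhamel 1 s v v t x) →
      ∃ b : EuclideanSpace ℝ (Fin 3), ∀ t < 0, ∀ x, v t x = b :=
  Summit.NavierStokesRegularity.NavierStokesRegularity.Theorems.oseenMild_liouville_of_knssGauge_of_persistentMild
    stub_typeIAncientLiouville_knssGauge stub_persistent_mild_backward_L3_recurrence

/-- **Assembly: the crux BY NAME from the registered stubs BY NAME** (the skeleton theorem read by
`#h21_check_skeleton`; no Prop hypotheses; no direct `sorry` — it inherits the two stubs'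
placeholders and adds none): L' and S3ᵐ give (L) for print's class, and the Oseen gauge theorem
(`TypeIliouvilleL_of_oseenMild_const`, p166043) transports it to the crux's duality-form class. -/
theorem TypeIliouvilleL_of :
    Summit.NavierStokesRegularity.NavierStokesRegularity.Theses.TypeILiouville.TypeIliouvilleL :=
  Summit.NavierStokesRegularity.NavierStokesRegularity.Theorems.TypeIliouvilleL_of_knssGauge_of_persistentMild
    stub_typeIAncientLiouville_knssGauge stub_persistent_mild_backward_L3_recurrence

/-! ### Certificates wired to the stubs (kernel-checked elsewhere, restated on the stubs by name) -/

/-- **Lossless:** the crux implies both stubs' statements (so neither stub is false unless the crux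
is): L' by `typeIAncientLiouville_knssGauge_of_TypeIliouvilleL` (p165901), S3ᵐ by
`persistentMild_of_TypeIliouvilleL` (p172276). -/
theorem stubs_of_TypeIliouvilleL
    (hL : Summit.NavierStokesRegularity.NavierStokesRegularity.Theses.TypeILiouville.TypeIliouvilleL) :
    (∀ (C : ℝ) (u : ℝ → EuclideanSpace ℝ (Fin 3) → EuclideanSpace ℝ (Fin 3)),
      ContDiffOn ℝ (⊤ : ℕ∞) (Function.uncurry u) (Set.Iio 0 ×ˢ Set.univ) ∧
      (∀ t < 0, Literature.Analysis.FluidPDE.VectorCalculus.IsDivFree (u t)) ∧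
      (∀ s t : ℝ, s < t → t < 0 → ∀ x,
        u t x = Literature.Analysis.FluidPDE.heatFlow (u s) (t - s) x -
          ∫ τ in Set.Ioo s t, ∫ y,
            Literature.Analysis.FluidPDE.oseenKernel (t - τ) (x - y) (u τ y) (u τ y)) ∧
      Literature.Analysis.FluidPDE.HasTypeITimeDecay C u →
      ∀ t < 0, ∀ x, u t x = 0) ∧
    (∀ v : ℝ → EuclideanSpace ℝ (Fin 3) → EuclideanSpace ℝ (Fin 3),
      ContinuousOn (uncurry v) (Iio 0 ×ˢ univ) →
      (∃ K : ℝ, ∀ t < 0, ∀ x, ‖v t x‖ ≤ K) →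
      (∀ t < 0, Literature.Analysis.FluidPDE.IsWeaklyDivFree (v t)) →
      (∀ s t : ℝ, s < t → t < 0 → ∀ x,
        v t x = Literature.Analysis.UnboundedOperators.heatExtension (v s) (t - s) x -
          Literature.Analysis.FluidPDE.oseenDuhamel 1 s v v t x) →
      (¬ ∃ C : ℝ, ∀ t < 0, ∀ x, ‖v t x‖ ≤ C / Real.sqrt (-t)) →
      ∃ (b : ℕ → EuclideanSpace ℝ (Fin 3)) (τ : ℕ → ℝ) (M : NNReal),
        (∀ k, τ k < 0) ∧ Tendsto τ atTop atBot ∧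
        ∀ k, eLpNorm (fun x => v (τ k) x - b k) 3
          (volume : Measure (EuclideanSpace ℝ (Fin 3))) ≤ (M : ENNReal)) :=
  (Summit.NavierStokesRegularity.NavierStokesRegularity.Theorems.TypeIliouvilleL_iff_knssGauge_and_persistentMild.1
    hL)

end Summit.NavierStokesRegularity.NavierStokesRegularity.Cruxes.TypeIliouvilleL.Birth
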